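import Literature.MathematicalPhysics.QuantumFieldTheory.Balaban1983to89.MassGapFunctionalInequalities
import Literature.Dynamics.Contraction.HopfIntegralOperatorSpectralRatio
import HarnessLib

/-!
# An EXPLICIT finite-volume gap for Lüscher's transfer matrix of Wilson's lattice gauge theory, by Hopf's inequality:
# `λᵢ ≤ tanh(3Nβ L³)·λ₀` for every eigenvalue other than the top one (`L = 2S+1`), i.e. `TransferGap ρ β S m` with
# `m = −log tanh(3NβL³) ≥ e^{−6NβL³}`

Topic `Literature/MathematicalPhysics/QuantumFieldTheory`; companion of `WilsonTorusTransferMatrix.lean` (the operator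
`𝕋 = wilsonTorusTransferMatrix ρ β L`, its kernel `wilsonSliceKernel`, spectral data) and of
`Balaban1983to89/MassGapFunctionalInequalities.lean` §8b (the Jaffe–Witten gap currencies `TransferOperatorGap`,
`TransferGap`, and `exists_pos_transferGap`: SOME `m > 0` exists, by Jentzsch).  THEOREMS ONLY (no definition, no named
fact): the existential `m` of `exists_pos_transferGap` is made EXPLICIT by E. Hopf's inequality for positive integral
operators (`Literature/Dynamics/Contraction/HopfIntegralOperatorSpectralRatio.lean`).

THE ARGUMENT.  The time-slice kernel is `K(U,V) = a(U)·I(U,V)·a(V)` with `a = e^{−βS₃∕2} > 0` and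
`I(U,V) = ∫ e^{−β S_tm(U,g,V)} dg`, where the temporal plaquette energy satisfies `0 ≤ S_tm ≤ 6NL³` for unitary `ρ`
(`3L³` temporal plaquettes, each `N − Re tr ρ(·) ∈ [0, 2N]`; `sliceTemporalAction_nonneg`, `sliceTemporalAction_le`).
Hence `e^{−6NβL³} ≤ I ≤ 1` and the half-weights CANCEL in the `2 × 2` cross-ratios:
`K(U,V)K(U',V')∕(K(U,V')K(U',V)) = I(U,V)I(U',V')∕(I(U,V')I(U',V)) ≤ e^{12NβL³}` (`wilsonSliceKernel_crossRatio_le`) — the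
projective diameter of `𝕋` is `Δ(𝕋) ≤ 12NβL³` [EvesonNussbaum1995, Thm 6.3 (11) p. 52: `Δ(A) = log max k(s,t)k(u,v)∕
(k(s,v)k(u,t))` for a positive continuous kernel on a compact space with a measure of full support — here `G^{E₃}` with
the product Haar probability].  Hopf's theorem [Hopf1963, Thm 4; AnseloneLee1974, Thm 6.2] then bounds every eigenvalue
of the (compact, self-adjoint, positivity improving) operator `𝕋` other than the simple top one `λ₀ = ‖𝕋‖`:
`|λᵢ| ≤ tanh(Δ∕4)·λ₀ = tanh(3NβL³)·λ₀` (`abs_eigenvalue_le_tanh_mul`), which is the operator gap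
`TransferOperatorGap ρ β S m` for every `m` with `tanh(3Nβ(2S+1)³) ≤ e^{−m}` (`transferOperatorGap_of_tanh_le`), hence
(tree `transferOperatorGap_iff_transferGap`) the trace-form gap `TransferGap ρ β S m` (`transferGap_of_tanh_le`); in
particular `m = −log tanh(3Nβ(2S+1)³)` (`transferGap_neg_log_tanh`) and the elementary positive value
`m = e^{−6Nβ(2S+1)³}` (`transferGap_exp_neg`, via `tanh x ≤ 1 − e^{−2x} ≤ exp(−e^{−2x})`).

HONEST FRAMING.  This is the census row B6 input "Birkhoff–Hopf cone contraction with osc = O(β·L³)" made a tree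
theorem in the cell's own currency: an EXPLICIT but VOLUME-DEPENDENT lattice gap, `m(β,S) ≥ e^{−6Nβ(2S+1)³}`, which
tends to `0` exponentially fast in the spatial volume and says NOTHING volume-uniform — it is NOT a mass gap, does not
bear on `BalabanLadder.IR` ∕ `IRcof` ∕ THE NUMBER, and the Yang–Mills mass gap (Clay) is NOT proved by any of this; R4
closes only the conditional finite-𝕋⁴ rung `BalabanLadder.UV`.  What it does give: a quantitative floor under the
finite-volume gap that every seat may cite by decl (e.g. the gap of a fixed torus cannot be smaller than `e^{−6NβL³}`,
so "no gap at finite volume" scenarios are excluded with a rate).  No `def`, no `instance`, no `sorry`; standard axioms.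

## References
* [Hopf1963] E. Hopf, *An inequality for positive linear integral operators*, J. Math. Mech. 12 (1963) 683–692, Thm 4.
* [AnseloneLee1974] P. M. Anselone, J. W. Lee, Linear Algebra Appl. 9 (1974) 67–87, §6, Thm 6.2 (Hopf: `|λ| ≤ ((M−m)∕(M+m))·r(K)`).
* [EvesonNussbaum1995] S. P. Eveson, R. D. Nussbaum, Math. Proc. Camb. Phil. Soc. 117 (1995) 31–55, Thm 6.3 (10)–(11)
  pp. 52–53 (projective diameter of an integral operator), p. 32 (spectral clearance).
* [MontvayMunster1994] I. Montvay, G. Münster, *Quantum Fields on a Lattice*, §3.2.6 (3.137)–(3.146) (the transfer matrix).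
* [Luscher1977] M. Lüscher, Commun. Math. Phys. 54 (1977) 283 (positivity of the transfer matrix).
* [ReedSimonIV1978] Thm XIII.43–44 (Jentzsch ∕ Perron–Frobenius: the top eigenvalue is simple with a positive eigenvector).
-/

noncomputable section

open MeasureTheory Filter Function Real
open scoped RealInnerProductSpace
open Literature.Analysis.OperatorTheory Literature.Dynamics.Contraction.BirkhoffHopf
open Literature.Barriers.QuantumFields
open Literature.MathematicalPhysics.QuantumFieldTheory.Balaban1983to89.Sufficient

namespace Literature.MathematicalPhysics.QuantumFieldTheory

namespace WilsonTransferGapExplicit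

variable {G : Type} [Group G] {N : ℕ} (ρ : G →* Matrix (Fin N) (Fin N) ℂ) {L : ℕ} [NeZero L]

/-! ## §1 The temporal plaquette energy is between `0` and `6NL³` -/

/-- `#Site 3 L = L³` (plumbing). [folklore] -/
private theorem card_site_three : Fintype.card (Site 3 L) = L ^ 3 := by
  rw [Fintype.card_pi, Finset.prod_const, ZMod.card, Finset.card_univ, Fintype.card_fin]

/-- **`S_tm ≥ 0`** for unitary `ρ`: each temporal plaquette contributes `N − Re tr ρ(U_P) ≥ 0` (`|tr| ≤ N`).
[cite: MontvayMunster1994, §3.2.6 (3.140)–(3.142)] -/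
theorem sliceTemporalAction_nonneg (hρu : ∀ g, ρ g ∈ Matrix.unitaryGroup (Fin N) ℂ) (U : GaugeConfig 3 L G)
    (g : Site 3 L → G) (U' : GaugeConfig 3 L G) : 0 ≤ sliceTemporalAction ρ U g U' :=
  Finset.sum_nonneg fun _ _ => Finset.sum_nonneg fun _ _ => sub_nonneg.2 ((Complex.re_le_norm _).trans
    (FiniteTemperature.norm_trace_le_of_mem_unitaryGroup (hρu _)))

/-- **`S_tm ≤ 6NL³`** for unitary `ρ`: `3L³` temporal plaquettes per slab, each contributing `N − Re tr ρ(U_P) ≤ 2N`.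
[cite: MontvayMunster1994, §3.2.6 (3.140)–(3.142)] -/
theorem sliceTemporalAction_le (hρu : ∀ g, ρ g ∈ Matrix.unitaryGroup (Fin N) ℂ) (U : GaugeConfig 3 L G)
    (g : Site 3 L → G) (U' : GaugeConfig 3 L G) : sliceTemporalAction ρ U g U' ≤ 6 * N * (L : ℝ) ^ 3 := by
  unfold sliceTemporalAction
  calc ∑ x : Site 3 L, ∑ i : Fin 3, ((N : ℝ) - (ρ (g x * U' (x, i) * (g (x.shift i))⁻¹ * (U (x, i))⁻¹)).trace.re)
      ≤ ∑ _x : Site 3 L, ∑ _i : Fin 3, (2 * N : ℝ) := by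
        refine Finset.sum_le_sum fun x _ => Finset.sum_le_sum fun i _ => ?_
        have h1 := Complex.abs_re_le_norm (ρ (g x * U' (x, i) * (g (x.shift i))⁻¹ * (U (x, i))⁻¹)).trace
        have h2 := FiniteTemperature.norm_trace_le_of_mem_unitaryGroup
          (hρu (g x * U' (x, i) * (g (x.shift i))⁻¹ * (U (x, i))⁻¹))
        rw [abs_le] at h1
        linarith [h1.1]
    _ = 6 * N * (L : ℝ) ^ 3 := by
        rw [Finset.sum_const, Finset.sum_const, Finset.card_univ, Finset.card_univ, Fintype.card_fin,
          card_site_three]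
        simp only [nsmul_eq_mul]
        push_cast
        ring

/-! ## §2 The cross-ratio diameter of the Wilson time-slice kernel is at most `12NβL³` -/

variable [TopologicalSpace G] [IsTopologicalGroup G] [CompactSpace G] [MeasurableSpace G] [BorelSpace G]

/-- The algebra of the cancellation of the half-weights in the cross-ratio (plumbing). [folklore] -/
private theorem crossRatio_aux {aU aV aU' aV' I₁ I₂ I₃ I₄ E : ℝ} (haU : 0 ≤ aU) (haV : 0 ≤ aV) (haU' : 0 ≤ aU')
    (haV' : 0 ≤ aV') (h12 : I₁ * I₂ ≤ 1) (h34 : 1 ≤ E * (I₃ * I₄)) :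
    aU * I₁ * aV * (aU' * I₂ * aV') ≤ E * (aU * I₃ * aV' * (aU' * I₄ * aV)) := by
  have hP : 0 ≤ aU * aV * aU' * aV' := by positivity
  calc aU * I₁ * aV * (aU' * I₂ * aV') = (aU * aV * aU' * aV') * (I₁ * I₂) := by ring
    _ ≤ (aU * aV * aU' * aV') * 1 := mul_le_mul_of_nonneg_left h12 hP
    _ ≤ (aU * aV * aU' * aV') * (E * (I₃ * I₄)) := mul_le_mul_of_nonneg_left h34 hP
    _ = E * (aU * I₃ * aV' * (aU' * I₄ * aV)) := by ring

variable [SecondCountableTopology G]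

/-- **The Gauss-law factor is between `e^{−6NβL³}` and `1`**: `e^{−6NβL³} ≤ ∫ e^{−β S_tm(U,g,V)} ∏ dg ≤ 1` for `β ≥ 0`,
continuous unitary `ρ`. [cite: MontvayMunster1994, §3.2.6 (3.144)] -/
theorem exp_neg_le_integral_exp_neg_sliceTemporalAction_le (hρ : Continuous ρ)
    (hρu : ∀ g, ρ g ∈ Matrix.unitaryGroup (Fin N) ℂ) {β : ℝ} (hβ : 0 ≤ β) (U V : GaugeConfig 3 L G) :
    Real.exp (-(β * (6 * N * (L : ℝ) ^ 3))) ≤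
        ∫ g, Real.exp (-(β * sliceTemporalAction ρ U g V)) ∂(Measure.pi fun _ : Site 3 L => haarProbability G) ∧
      ∫ g, Real.exp (-(β * sliceTemporalAction ρ U g V)) ∂(Measure.pi fun _ : Site 3 L => haarProbability G) ≤ 1 := by
  have hcont : Continuous fun g : Site 3 L → G => Real.exp (-(β * sliceTemporalAction ρ U g V)) :=
    Real.continuous_exp.comp ((continuous_const.mul ((continuous_sliceTemporalAction ρ hρ).comp
      (continuous_const.prodMk (continuous_id.prodMk continuous_const)))).neg)
  have hint : Integrable (fun g : Site 3 L → G => Real.exp (-(β * sliceTemporalAction ρ U g V)))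
      (Measure.pi fun _ : Site 3 L => haarProbability G) :=
    integrable_of_abs_le_one hcont.measurable fun g =>
      (Real.abs_exp _).trans_le (exp_neg_sliceTemporalAction_le_one ρ hρu hβ U g V)
  refine ⟨?_, (le_abs_self _).trans (abs_integral_le_one fun g =>
    (Real.abs_exp _).trans_le (exp_neg_sliceTemporalAction_le_one ρ hρu hβ U g V))⟩
  have hc : ∫ _g : Site 3 L → G, Real.exp (-(β * (6 * N * (L : ℝ) ^ 3)))
      ∂(Measure.pi fun _ : Site 3 L => haarProbability G) = Real.exp (-(β * (6 * N * (L : ℝ) ^ 3))) := by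
    simp
  rw [← hc]
  exact integral_mono (integrable_const _) hint fun g => Real.exp_le_exp.2
    (neg_le_neg (mul_le_mul_of_nonneg_left (sliceTemporalAction_le ρ hρu U g V) hβ))

/-- **THE CROSS-RATIO DIAMETER OF THE WILSON TIME-SLICE KERNEL IS AT MOST `12NβL³`**: for `β ≥ 0` and continuous
unitary `ρ`, `K(U,V)·K(U',V') ≤ e^{12NβL³}·K(U,V')·K(U',V)` for all slices `U, U', V, V'`, `K = wilsonSliceKernel ρ β` —
the half-weights `e^{−βS₃∕2}` cancel and each Gauss-law factor lies in `[e^{−6NβL³}, 1]`.  In Eveson–Nussbaum's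
notation: the projective diameter of Lüscher's transfer matrix satisfies `Δ(𝕋) ≤ 12NβL³`.
[cite: EvesonNussbaum1995, Thm 6.3 (11) p. 52 and Remark 6.4 p. 53; MontvayMunster1994, §3.2.6 (3.144)] -/
theorem wilsonSliceKernel_crossRatio_le (hρ : Continuous ρ) (hρu : ∀ g, ρ g ∈ Matrix.unitaryGroup (Fin N) ℂ)
    {β : ℝ} (hβ : 0 ≤ β) (U U' V V' : GaugeConfig 3 L G) :
    wilsonSliceKernel ρ β U V * wilsonSliceKernel ρ β U' V' ≤
      Real.exp (12 * N * β * (L : ℝ) ^ 3) * (wilsonSliceKernel ρ β U V' * wilsonSliceKernel ρ β U' V) := by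
  have hI := fun U V => exp_neg_le_integral_exp_neg_sliceTemporalAction_le (L := L) ρ hρ hρu hβ U V
  unfold wilsonSliceKernel
  refine crossRatio_aux (Real.exp_pos _).le (Real.exp_pos _).le (Real.exp_pos _).le (Real.exp_pos _).le ?_ ?_
  · exact mul_le_one₀ (hI U V).2 (integral_nonneg fun g => (Real.exp_pos _).le) (hI U' V').2
  · have h0 : 0 < Real.exp (-(β * (6 * N * (L : ℝ) ^ 3))) := Real.exp_pos _
    calc (1 : ℝ) = Real.exp (12 * N * β * (L : ℝ) ^ 3) *
          (Real.exp (-(β * (6 * N * (L : ℝ) ^ 3))) * Real.exp (-(β * (6 * N * (L : ℝ) ^ 3)))) := by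
          rw [← Real.exp_add, ← Real.exp_add, eq_comm, Real.exp_eq_one_iff]; ring
      _ ≤ Real.exp (12 * N * β * (L : ℝ) ^ 3) *
          ((∫ g, Real.exp (-(β * sliceTemporalAction ρ U g V')) ∂(Measure.pi fun _ : Site 3 L => haarProbability G)) *
           ∫ g, Real.exp (-(β * sliceTemporalAction ρ U' g V)) ∂(Measure.pi fun _ : Site 3 L => haarProbability G)) :=
          mul_le_mul_of_nonneg_left (mul_le_mul (hI U V').1 (hI U' V).1 h0.le
            (integral_nonneg fun g => (Real.exp_pos _).le)) (Real.exp_pos _).le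

/-! ## §3 Hopf's bound on the spectrum of the transfer matrix and the explicit gap -/

/-- `tanh x ≤ exp(−e^{−2x})` for `x ≥ 0`: `tanh x = (e^{2x} − 1)∕(e^{2x} + 1) ≤ 1 − e^{−2x} ≤ exp(−e^{−2x})` (plumbing for the
elementary form of the gap). [folklore] -/
private theorem tanh_le_exp_neg_exp_neg {x : ℝ} (hx : 0 ≤ x) : Real.tanh x ≤ Real.exp (-Real.exp (-(2 * x))) := by
  have ht : Real.tanh x = (Real.exp (2 * x) - 1) / (Real.exp (2 * x) + 1) := by
    have h := tanh_quarter_eq (4 * x)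
    rw [show (4 * x) / 4 = x by ring, show (4 * x) / 2 = 2 * x by ring] at h
    exact h
  set v := Real.exp (2 * x) with hv
  have hv1 : 1 ≤ v := Real.one_le_exp (by linarith)
  have hv0 : 0 < v := by linarith
  have hinv : Real.exp (-(2 * x)) = v⁻¹ := by rw [hv, Real.exp_neg]
  rw [ht, hinv]
  have hi1 : v⁻¹ ≤ 1 := inv_le_one_of_one_le₀ hv1
  have hvv : v * v⁻¹ = 1 := mul_inv_cancel₀ hv0.ne'
  calc (v - 1) / (v + 1) ≤ 1 - v⁻¹ := by
        rw [div_le_iff₀ (by linarith)]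
        nlinarith [hvv, hi1]
    _ ≤ Real.exp (-v⁻¹) := by linarith [Real.add_one_le_exp (-v⁻¹)]

/-- `tanh x ≥ 0` for `x ≥ 0` (plumbing). [folklore] -/
private theorem tanh_nonneg' {x : ℝ} (hx : 0 ≤ x) : 0 ≤ Real.tanh x := by
  have h := tanh_quarter_nonneg (Δ := 4 * x) (by linarith)
  rwa [show (4 * x) / 4 = x by ring] at h

/-- **HOPF's BOUND ON THE SPECTRUM OF LÜSCHER's TRANSFER MATRIX.**  `β ≥ 0`, continuous unitary `ρ`, spatial torus of
side `L`.  For ANY Hilbert basis `b` of eigenvectors of `𝕋 = wilsonTorusTransferMatrix ρ β L` (`𝕋 bᵢ = λᵢ bᵢ`) and any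
index `i₀` with `λ_{i₀} = ‖𝕋‖`: every other eigenvalue satisfies `|λᵢ| ≤ tanh(3NβL³)·‖𝕋‖`.  (The top eigenspace is
the line of the Jentzsch vector `φ > 0`, `IsPositivityImproving.exists_spectralGap`; `b_{i₀} = ±φ`, so `bᵢ ⊥ φ` for
`i ≠ i₀`, and `abs_eigenvalue_le_tanh_mul_of_kernel_of_inner_eq_zero` applies with `Δ = 12NβL³`.)
[cite: Hopf1963, Thm 4; AnseloneLee1974, Thm 6.2; EvesonNussbaum1995, Thm 6.3 pp. 52–53 and p. 32; MontvayMunster1994, §3.2.6 (3.144)–(3.146)] -/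
theorem abs_eigenvalue_le_tanh_mul (hρ : Continuous ρ) (hρu : ∀ g, ρ g ∈ Matrix.unitaryGroup (Fin N) ℂ)
    {β : ℝ} (hβ : 0 ≤ β) {ι : Type*}
    (b : HilbertBasis ι ℝ (Lp ℝ 2 (Measure.pi fun _ : Edge 3 L => haarProbability G))) {lam : ι → ℝ}
    (hb : ∀ i, wilsonTorusTransferMatrix ρ β L (b i) = lam i • b i) {i₀ : ι}
    (hi₀ : lam i₀ = ‖wilsonTorusTransferMatrix ρ β L‖) {i : ι} (hi : i ≠ i₀) :
    |lam i| ≤ Real.tanh (3 * N * β * (L : ℝ) ^ 3) * ‖wilsonTorusTransferMatrix ρ β L‖ := by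
  set A := wilsonTorusTransferMatrix ρ β L with hA_def
  have hsa : IsSelfAdjoint A := isSelfAdjoint_wilsonTorusTransferMatrix L hρ hρu β
  have hc : IsCompactOperator A := isCompactOperator_wilsonTorusTransferMatrix β L hρ
  have himp : IsPositivityImproving A := isPositivityImproving_wilsonTorusTransferMatrix β L hρ
  have h0 : A ≠ 0 := wilsonTorusTransferMatrix_ne_zero β L hρ
  obtain ⟨φ, hφ1, hφpos, hAφ, huniq, -⟩ := himp.exists_spectralGap hsa hc h0
  have hφ0 : φ ≠ 0 := by rw [← norm_ne_zero_iff, hφ1]; exact one_ne_zero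
  have hμ := measure_ne_zero_of_ne_zero hφ0
  have hφP : IsPositiveFun φ := hφpos.isPositiveFun hμ
  -- the top basis vector is on the Jentzsch line, so the others are orthogonal to `φ`
  have hbi₀ : (b i₀ : Lp ℝ 2 (Measure.pi fun _ : Edge 3 L => haarProbability G)) = ⟪φ, b i₀⟫ • φ :=
    huniq _ (by rw [hb, hi₀])
  set c₀ : ℝ := ⟪φ, b i₀⟫ with hc₀_def
  have hc₀ : c₀ ≠ 0 := fun h => by
    have h1 := hbi₀
    rw [h, zero_smul] at h1
    exact b.orthonormal.ne_zero i₀ h1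
  have horth : ⟪φ, b i⟫ = 0 := by
    have hφeq : φ = c₀⁻¹ • (b i₀ : Lp ℝ 2 (Measure.pi fun _ : Edge 3 L => haarProbability G)) := by
      rw [hbi₀, smul_smul, inv_mul_cancel₀ hc₀, one_smul]
    rw [hφeq, real_inner_smul_left, b.orthonormal.2 hi.symm, mul_zero]
  -- kernel data and Hopf's theorem
  have hKm := stronglyMeasurable_uncurry_wilsonSliceKernel (L := L) ρ hρ β
  obtain ⟨C, hC⟩ := exists_norm_wilsonSliceKernel_le (L := L) ρ hρ β
  have hK := wilsonSliceKernel_pos (L := L) ρ hρ β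
  have hΔ : ∀ U U' V V' : GaugeConfig 3 L G, wilsonSliceKernel ρ β U V * wilsonSliceKernel ρ β U' V' ≤
      Real.exp (12 * N * β * (L : ℝ) ^ 3) * (wilsonSliceKernel ρ β U V' * wilsonSliceKernel ρ β U' V) :=
    wilsonSliceKernel_crossRatio_le ρ hρ hρu hβ
  have hAe := wilsonTorusTransferMatrix_ae_eq β L hρ (ρ := ρ)
  have h := abs_eigenvalue_le_tanh_mul_of_kernel_of_inner_eq_zero hKm hC hK hΔ hAe hφP hAφ (hb i)
    (b.orthonormal.ne_zero i) horth
  rwa [show (12 * N * β * (L : ℝ) ^ 3) / 4 = 3 * N * β * (L : ℝ) ^ 3 by ring] at h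

/-- **THE OPERATOR GAP, EXPLICITLY.**  `β ≥ 0`, continuous unitary `ρ`: for every `m` with `tanh(3Nβ(2S+1)³) ≤ e^{−m}`,
`TransferOperatorGap ρ β S m` — Lüscher's transfer matrix on the spatial torus of side `2S+1` has a unit top eigenvector
`Ω` and `‖𝕋w‖ ≤ e^{−m}‖𝕋‖‖w‖` on `Ω^⊥`.  (Hopf's eigenvalue bound for a Hilbert basis of eigenvectors
(`exists_spectralData_wilsonTorusTransferMatrix`) + Parseval, tree `norm_apply_le_of_eigenbasis_of_inner_eq_zero`.)
[cite: Hopf1963, Thm 4; EvesonNussbaum1995, p. 32 (explicit spectral clearance) and Thm 6.3; JaffeWitten2000, §5] -/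
theorem transferOperatorGap_of_tanh_le (hρ : Continuous ρ) (hρu : ∀ g, ρ g ∈ Matrix.unitaryGroup (Fin N) ℂ)
    {β : ℝ} (hβ : 0 ≤ β) (S : ℕ) {m : ℝ}
    (hm : Real.tanh (3 * N * β * (2 * (S : ℝ) + 1) ^ 3) ≤ Real.exp (-m)) : TransferOperatorGap ρ β S m := by
  classical
  obtain ⟨s, _, b, lam, i₀, hb, hlam, hpos, hnorm, -, -, -⟩ :=
    exists_spectralData_wilsonTorusTransferMatrix (2 * S + 1) hρ hρu hβ
  set A := wilsonTorusTransferMatrix ρ β (2 * S + 1) with hA_def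
  have hsa : IsSelfAdjoint A := isSelfAdjoint_wilsonTorusTransferMatrix (2 * S + 1) hρ hρu β
  set τ : ℝ := Real.tanh (3 * N * β * (2 * (S : ℝ) + 1) ^ 3) with hτ
  have hτ0 : 0 ≤ τ := tanh_nonneg' (by positivity)
  have hle : ∀ i, i ≠ i₀ → |lam i| ≤ τ * ‖A‖ := fun i hi => by
    have h := abs_eigenvalue_le_tanh_mul (L := 2 * S + 1) ρ hρ hρu hβ b hb hnorm hi
    push_cast at h
    exact h
  refine ⟨b i₀, b.orthonormal.1 i₀, by rw [hb, hnorm], fun w hw => ?_⟩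
  have h := norm_apply_le_of_eigenbasis_of_inner_eq_zero b hsa hb i₀ (θ := τ * ‖A‖)
    (mul_nonneg hτ0 (norm_nonneg _)) hle hw
  calc ‖A w‖ ≤ τ * ‖A‖ * ‖w‖ := h
    _ ≤ Real.exp (-m) * ‖A‖ * ‖w‖ :=
        mul_le_mul_of_nonneg_right (mul_le_mul_of_nonneg_right hm (norm_nonneg _)) (norm_nonneg _)

/-- **THE TRACE-FORM GAP, EXPLICITLY**: `β ≥ 0`, continuous unitary `ρ`, `tanh(3Nβ(2S+1)³) ≤ e^{−m}` ⇒
`TransferGap ρ β S m`, i.e. `X_{β,2S+1}(T+1) ≤ e^{−m} X_{β,2S+1}(T)` for the trace excess of every cold torus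
(tree `transferOperatorGap_iff_transferGap`). [cite: Hopf1963, Thm 4; EvesonNussbaum1995, Thm 6.3 and p. 32; MontvayMunster1994, §3.2.6 (3.145)] -/
theorem transferGap_of_tanh_le (hρ : Continuous ρ) (hρu : ∀ g, ρ g ∈ Matrix.unitaryGroup (Fin N) ℂ)
    {β : ℝ} (hβ : 0 ≤ β) (S : ℕ) {m : ℝ}
    (hm : Real.tanh (3 * N * β * (2 * (S : ℝ) + 1) ^ 3) ≤ Real.exp (-m)) : TransferGap ρ β S m :=
  (transferOperatorGap_iff_transferGap hρ hρu hβ S m).1 (transferOperatorGap_of_tanh_le ρ hρ hρu hβ S hm)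

/-- **EVERY FINITE TORUS HAS THE EXPLICIT TRANSFER GAP `m = −log tanh(3Nβ(2S+1)³)`** (`β ≥ 0`, continuous unitary `ρ`):
`λᵢ ≤ tanh(3Nβ(2S+1)³)·λ₀` for all `i ≠ i₀` in the trace form.  Hopf's constant: with `M∕m′` the ratio of the largest
to the smallest value of the Gauss-law factor, `tanh(3NβL³) = (M − m′)∕(M + m′)` at `M∕m′ = e^{6NβL³}`.
[cite: Hopf1963, Thm 4; AnseloneLee1974, Thm 6.2; EvesonNussbaum1995, Thm 6.3 pp. 52–53] -/
theorem transferGap_neg_log_tanh (hρ : Continuous ρ) (hρu : ∀ g, ρ g ∈ Matrix.unitaryGroup (Fin N) ℂ)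
    {β : ℝ} (hβ : 0 ≤ β) (S : ℕ) :
    TransferGap ρ β S (-Real.log (Real.tanh (3 * N * β * (2 * (S : ℝ) + 1) ^ 3))) :=
  transferGap_of_tanh_le ρ hρ hρu hβ S (by rw [neg_neg]; exact Real.le_exp_log _)

/-- **… IN ELEMENTARY FORM: the finite-volume gap is at least `e^{−6Nβ(2S+1)³}`** (`β ≥ 0`, continuous unitary `ρ`):
`TransferGap ρ β S (e^{−6Nβ(2S+1)³})`, since `tanh x ≤ 1 − e^{−2x} ≤ exp(−e^{−2x})`.  Explicit, positive for every `β`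
and `S`, and exponentially small in the spatial volume: a finite-volume statement, NOT a mass gap.
[cite: Hopf1963, Thm 4; EvesonNussbaum1995, Thm 6.3 pp. 52–53; JaffeWitten2000, §5 (what a mass gap would require: uniformity in the volume)] -/
theorem transferGap_exp_neg (hρ : Continuous ρ) (hρu : ∀ g, ρ g ∈ Matrix.unitaryGroup (Fin N) ℂ)
    {β : ℝ} (hβ : 0 ≤ β) (S : ℕ) :
    TransferGap ρ β S (Real.exp (-(6 * N * β * (2 * (S : ℝ) + 1) ^ 3))) :=
  transferGap_of_tanh_le ρ hρ hρu hβ S (by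
    have h := tanh_le_exp_neg_exp_neg (x := 3 * N * β * (2 * (S : ℝ) + 1) ^ 3) (by positivity)
    rwa [show 2 * (3 * N * β * (2 * (S : ℝ) + 1) ^ 3) = 6 * N * β * (2 * (S : ℝ) + 1) ^ 3 by ring] at h)

/-- **Corollary: an explicit witness for `exists_pos_transferGap`** — `∃ m ≥ e^{−6Nβ(2S+1)³} > 0` with `TransferGap ρ β S m`.
[cite: Hopf1963, Thm 4; ReedSimonIV1978, Thm XIII.43 and Thm XIII.44] -/
theorem exists_transferGap_ge_exp_neg (hρ : Continuous ρ) (hρu : ∀ g, ρ g ∈ Matrix.unitaryGroup (Fin N) ℂ)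
    {β : ℝ} (hβ : 0 ≤ β) (S : ℕ) :
    ∃ m : ℝ, Real.exp (-(6 * N * β * (2 * (S : ℝ) + 1) ^ 3)) ≤ m ∧ 0 < m ∧ TransferGap ρ β S m :=
  ⟨_, le_rfl, Real.exp_pos _, transferGap_exp_neg ρ hρ hρu hβ S⟩

end WilsonTransferGapExplicit

end Literature.MathematicalPhysics.QuantumFieldTheory

end
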